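import Literature.Probability.LatticeModels.BoundaryEstimate
import Literature.Probability.LatticeModels.ObservableContinuumBounds
import Literature.Probability.LatticeModels.ExplorationWinding
import HarnessLib

/-!
# Boundary values of the FK primitive along a discretisation (Smirnov 2010, Thm. 5.3)

Topic `Literature/Probability/LatticeModels`; an instalment (item B3, eventually-in-the-mesh
packaging, of the road recorded in `Sweep1Proofs.lean`, module docstring §2b) of the discharge
programme for crit-ising.S18 / Smirnov's Theorem 2.2. For an `IsDiscretisation` family of a
Dobrushin domain `(D; a, b)` and a point `p` of the open arc `(ab)` (resp. `(ba)`), for every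
`η > 0` there is `ρ > 0` such that for all small meshes every FK primitive constant on the arcs
satisfies `Hw v - H_A ≤ η` (resp. `H_B - Hw v ≤ η`) at the sites `v` cornering inner faces with
`dist(δv, p) < ρ` (`IsDiscretisation.eventually_hw_sub_le_near_arcA`,
`IsDiscretisation.eventually_sub_hw_le_near_arcB`). Ingredients: the other discrete arc stays
away from `p` (`eventually_zdArcB_far`, `eventually_zdArcA_far`: Hausdorff convergence of the
arcs); the flux is uniformly small near `p` (`eventually_dartFlux_le_near(')`: Theorem 5.1 via
`fkInterface_passageProb_le_holds` / `dartFlux_le_of_infDist`); the exterior lattice component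
reaches within `ρ/2` of `p` (`eventually_exists_extConn_near`, `ExteriorLatticePath.lean`) and
its complement is hole-free, so the lattice estimates of `BoundaryEstimate.lean` apply with
`J` chosen from `η`. Everything is proved.

## References

* S. Smirnov, Ann. of Math. 172 (2010) 1435–1467, §5, Theorem 5.3 and Lemma B.3 — bib key
  `Smirnov2010`.
-/

noncomputable section

namespace Literature.Probability.LatticeModels

open WeakBeurling (sqBox sqBox_mono mem_sqBox_succ_of_adj)
open Set Metric Filter _root_.Topology
open scoped Pointwise

/-! ### Discrete boundary sites are close to the boundary curve -/

/-- **Every site of the discrete boundary `∂Ω_δ` of a discretised Jordan domain is within `2δ` of a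
point of `∂D`** (a lattice neighbour not joined in `Ω_δ` gives a point off `D` on a unit segment; a
non-inner face cornered by the site gives a point off `D` in a closed unit square).
[cite: Smirnov2001, §2] -/
theorem exists_frontier_near_of_mem_zdBoundary₀ {Dm : RandomPlanarGeometry.JordanDomain} {E : DiscreteDobrushin}
    (hΩ : E.Ω = Dm.carrier) (hδ : 0 < E.δ) {u : Site 2} (hu : u ∈ E.zdBoundary) :
    ∃ z ∈ frontier Dm.carrier, dist z (meshPoint E.δ u) ≤ 2 * E.δ := by
  obtain ⟨Ω', δ, A', B'⟩ := E
  cases hΩ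
  change 0 < δ at hδ
  set D' : DiscreteDobrushin := ⟨Dm.carrier, δ, A', B'⟩ with hD'
  change u ∈ D'.zdBoundary at hu
  change ∃ z ∈ frontier Dm.carrier, dist z (meshPoint δ u) ≤ 2 * δ
  have huΩ : meshPoint δ u ∈ Dm.carrier :=
    meshDomain_subset_meshVertices _ _ (D'.zdBoundary_subset_meshDomain hu)
  -- frontier point on a segment from `δu` to a point off `Ω`
  have cross : ∀ {q : ℂ}, q ∉ Dm.carrier → ∃ z ∈ segment ℝ (meshPoint δ u) q, z ∈ frontier Dm.carrier := by
    intro q hq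
    obtain ⟨z, hz1, hz2⟩ := Dm.inter_frontier_nonempty_of_isPreconnected
      (convex_segment (meshPoint δ u) q).isPreconnected ⟨_, left_mem_segment _ _ _, huΩ⟩
      ⟨q, right_mem_segment _ _ _, hq⟩
    exact ⟨z, hz1, hz2⟩
  rcases D'.mem_zdBoundary_iff.1 hu with hu' | ⟨y, hadj, -, g, hg, hug, hyg⟩
  · -- `u ∈ meshBoundary`: a lattice neighbour `y` not `Ω_δ`-adjacent
    obtain ⟨huD, y, hzd, hnadj⟩ := mem_meshBoundary_iff.1 hu'
    have hdist : dist (meshPoint δ y) (meshPoint δ u) = δ := by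
      rw [dist_comm, Percolation.dist_meshPoint_of_adj hzd, abs_of_pos hδ]
    by_cases hseg : segment ℝ (meshPoint δ u) (meshPoint δ y) ⊆ closure Dm.carrier
    · -- then `δy ∉ Ω` (else `y ∈ Ω_δ`), so `δy ∈ ∂Ω`
      have hyΩ : meshPoint δ y ∉ Dm.carrier := by
        intro hyΩ
        apply hnadj
        rw [discreteDomainGraph_adj_iff]
        have hmesh : (meshGraph D'.Ω D'.δ).Adj u y := meshGraph_adj_iff.2 ⟨hzd, hseg⟩
        exact ⟨hmesh, huD, Percolation.mem_meshDomain_of_meshGraph_adj huD hyΩ hmesh⟩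
      refine ⟨meshPoint δ y, ⟨hseg (right_mem_segment _ _ _), ?_⟩, hdist.le.trans (by linarith)⟩
      rw [Dm.isOpen.interior_eq]; exact hyΩ
    · obtain ⟨q, hq, hqΩ⟩ := not_subset.1 hseg
      obtain ⟨z, hz, hzfr⟩ := cross (fun h => hqΩ (subset_closure h))
      have hsub : segment ℝ (meshPoint δ u) z ⊆ segment ℝ (meshPoint δ u) (meshPoint δ y) :=
        (convex_segment _ _).segment_subset (left_mem_segment _ _ _)
          ((convex_segment _ _).segment_subset (left_mem_segment _ _ _) hq hz)
      refine ⟨z, hzfr, ?_⟩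
      have hzball : z ∈ closedBall (meshPoint δ u) δ :=
        (convex_closedBall _ _).segment_subset (mem_closedBall.2 (by rw [dist_self]; exact hδ.le))
          (mem_closedBall.2 hdist.le) (hsub (right_mem_segment _ _ _))
      rw [mem_closedBall] at hzball; linarith
  · -- `u` is a corner of a non-inner face `g`: some point of `g` is off `Ω`
    have huD : u ∈ meshDomain D'.Ω D'.δ := (discreteDomainGraph_adj_iff.1 hadj).2.1
    have hsq : ∃ q ∈ δ • closedSq g, q ∉ Dm.carrier := by
      by_contra hall
      push Not at hall
      apply hg
      have hvert : ∀ v, IsCorner v g → meshPoint δ v ∈ Dm.carrier := fun v hv =>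
        hall _ (by rw [Percolation.meshPoint_eq_smul]; exact Set.smul_mem_smul_set (toComplex_mem_closedSq hv))
      have hmesh : ∀ v w, IsCorner v g → IsCorner w g → (zdGraph 2).Adj v w →
          (meshGraph D'.Ω D'.δ).Adj v w := by
        intro v w hv hw hvw
        refine meshGraph_adj_iff.2 ⟨hvw, fun p hp => subset_closure (hall p ?_)⟩
        rw [Percolation.meshPoint_eq_smul, Percolation.meshPoint_eq_smul, ← Percolation.smul_segment_eq] at hp
        obtain ⟨p', hp', rfl⟩ := hp
        exact Set.smul_mem_smul_set ((convex_closedSq g).segment_subset (toComplex_mem_closedSq hv)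
          (toComplex_mem_closedSq hw) hp')
      have hdom : ∀ v, IsCorner v g → v ∈ meshDomain D'.Ω D'.δ := by
        intro v hv
        rcases Percolation.IsCorner.exists_adj_chain hug hv with rfl | h | ⟨c, hc, h1, h2⟩
        · exact huD
        · exact Percolation.mem_meshDomain_of_meshGraph_adj huD (hvert v hv) (hmesh _ _ hug hv h)
        · exact Percolation.mem_meshDomain_of_meshGraph_adj
            (Percolation.mem_meshDomain_of_meshGraph_adj huD (hvert c hc) (hmesh _ _ hug hc h1)) (hvert v hv) (hmesh _ _ hc hv h2)
      intro v w hv hw hvw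
      exact discreteDomainGraph_adj_iff.2 ⟨hmesh v w hv hw hvw, hdom v hv, hdom w hw⟩
    obtain ⟨q, hq, hqΩ⟩ := hsq
    obtain ⟨z, hz, hzfr⟩ := cross hqΩ
    refine ⟨z, hzfr, ?_⟩
    -- `z` lies in the closed square `δ g`, whose points are within `2δ` of the corner `δ u`
    have hzsq : z ∈ δ • closedSq g := by
      have hu' : meshPoint δ u ∈ δ • closedSq g := by
        rw [Percolation.meshPoint_eq_smul]; exact Set.smul_mem_smul_set (toComplex_mem_closedSq hug)
      have hconv : Convex ℝ (δ • closedSq g) := (convex_closedSq g).smul δ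
      exact hconv.segment_subset hu' hq hz
    have hz' : δ⁻¹ • z ∈ closedSq g := (Set.mem_smul_set_iff_inv_smul_mem₀ hδ.ne' _ _).1 hzsq
    have hd : dist (δ⁻¹ • z) (Site.toComplex u) ≤ 2 := mem_closedBall.1 (closedSq_subset_closedBall hug hz')
    have e : dist z (meshPoint δ u) = ‖δ‖ * dist (δ⁻¹ • z) (Site.toComplex u) := by
      rw [← dist_smul₀, smul_inv_smul₀ hδ.ne', Percolation.meshPoint_eq_smul]
    rw [e, Real.norm_eq_abs, abs_of_pos hδ]
    nlinarith

/-! ### Sites of a discrete arc are close to its continuum label set -/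

/-- For a site of the discrete arc of `A'`, the distance to `A'` is at most the distance to any
boundary point. [cite: Smirnov2001, §2] -/
theorem infDist_le_dist_of_mem_zdDiscreteArc {E : DiscreteDobrushin} {A' : Set ℂ} {x : Site 2}
    (hx : x ∈ E.zdDiscreteArc A') {z : ℂ} (hz : z ∈ frontier E.Ω) :
    infDist (meshPoint E.δ x) A' ≤ dist (meshPoint E.δ x) z := by
  rw [DiscreteDobrushin.mem_zdDiscreteArc_iff] at hx
  by_cases hzA : z ∈ A'
  · exact infDist_le_dist_of_mem hzA
  · exact hx.2.trans (infDist_le_dist_of_mem ⟨hz, hzA⟩)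

/-- Under admissibility the label set of the arc `B` is nonempty (else the discrete arc of `B`
would be the whole discrete boundary and meet that of `A`). [cite: Smirnov2001, §2] -/
theorem DiscreteDobrushin.IsZdAdmissible.arcB_nonempty {E : DiscreteDobrushin} (hE : E.IsZdAdmissible) : E.arcB.Nonempty := by
  by_contra h
  rw [Set.not_nonempty_iff_eq_empty] at h
  obtain ⟨a, ha⟩ := hE.zdArcA_nonempty
  have haB : a ∈ E.zdArcB := by
    rw [DiscreteDobrushin.zdArcB, h, DiscreteDobrushin.mem_zdDiscreteArc_iff]
    exact ⟨E.zdArcA_subset_zdBoundary ha, by rw [infDist_empty]; exact infDist_nonneg⟩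
  exact Set.disjoint_left.1 hE.disjoint ha haB

/-- Under admissibility the label set of the arc `A` is nonempty. [cite: Smirnov2001, §2] -/
theorem DiscreteDobrushin.IsZdAdmissible.arcA_nonempty {E : DiscreteDobrushin} (hE : E.IsZdAdmissible) : E.arcA.Nonempty := by
  by_contra h
  rw [Set.not_nonempty_iff_eq_empty] at h
  obtain ⟨b, hb⟩ := hE.zdArcB_nonempty
  have hbA : b ∈ E.zdArcA := by
    rw [DiscreteDobrushin.zdArcA, h, DiscreteDobrushin.mem_zdDiscreteArc_iff]
    exact ⟨E.zdArcB_subset_zdBoundary hb, by rw [infDist_empty]; exact infDist_nonneg⟩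
  exact Set.disjoint_left.1 hE.disjoint hbA hb

/-! ### Along a discretisation: the discrete arcs stay away from the opposite open arcs -/

section Family

variable {D : RandomPlanarGeometry.DobrushinDomain} {E : ℝ → DiscreteDobrushin}

/-- **`B`-sites stay away from points off the arc `(ba)`**: for `p ∉ D.arc 1` there is `r > 0` with
`8r ≤ dist(p, arc 1)` such that, for all small meshes, every site of the discrete arc `B` has its
mesh point at distance `≥ 6r` from `p` (Hausdorff convergence of the label sets plus
`exists_frontier_near_of_mem_zdBoundary₀`). [cite: Smirnov2010, §5] -/
theorem IsDiscretisation.eventually_zdArcB_far (hDE : IsDiscretisation D E) {p : ℂ} (hp1 : p ∉ D.arc 1) :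
    ∃ r > 0, 8 * r ≤ infDist p (D.arc 1) ∧ ∀ᶠ δ in 𝓝[>] (0 : ℝ), (E δ).IsZdAdmissible →
      ∀ b ∈ (E δ).zdArcB, 6 * r ≤ dist (meshPoint δ b) p := by
  have hpos : 0 < infDist p (D.arc 1) :=
    ((D.isClosed_arc 1).notMem_iff_infDist_pos ⟨_, D.pt_mem_arc_self 1⟩).1 hp1
  refine ⟨infDist p (D.arc 1) / 8, by positivity, by linarith, ?_⟩
  set r := infDist p (D.arc 1) / 8 with hr
  have hr0 : 0 < r := by positivity
  have hH : ∀ᶠ δ in 𝓝[>] (0 : ℝ), hausdorffEDist (E δ).arcB (D.arc 1) < ENNReal.ofReal r :=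
    hDE.tendsto_arcB (Iio_mem_nhds (ENNReal.ofReal_pos.2 hr0))
  have hsmall : ∀ᶠ δ in 𝓝[>] (0 : ℝ), δ < r / 3 := nhdsWithin_le_nhds (Iio_mem_nhds (by positivity))
  filter_upwards [hH, hsmall, (self_mem_nhdsWithin : ∀ᶠ δ in 𝓝[>] (0 : ℝ), 0 < δ)] with δ hHδ hδs hδ0 hE b hb
  have hδ0' : 0 < δ := hδ0
  have hΩ := hDE.Ω_eq δ
  have hδE := hDE.δ_eq δ
  obtain ⟨z, hz, hzd⟩ := exists_frontier_near_of_mem_zdBoundary₀ (Dm := D.toJordanDomain) hΩ (by rw [hδE]; exact hδ0')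
    ((E δ).zdArcB_subset_zdBoundary hb)
  rw [hδE] at hzd
  have h1 : infDist (meshPoint δ b) (E δ).arcB ≤ 2 * δ := by
    have := infDist_le_dist_of_mem_zdDiscreteArc (A' := (E δ).arcB) hb (z := z) (by rw [hΩ]; exact hz)
    rw [hδE] at this
    rw [dist_comm] at hzd
    exact this.trans hzd
  obtain ⟨y, hy, hyd⟩ := (infDist_lt_iff hE.arcB_nonempty).1 (h1.trans_lt (by linarith : 2 * δ < 3 * δ))
  obtain ⟨y', hy', hyy'⟩ := exists_edist_lt_of_hausdorffEDist_lt hy hHδ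
  rw [edist_lt_ofReal] at hyy'
  have h2 : infDist p (D.arc 1) ≤ dist p y' := infDist_le_dist_of_mem hy'
  have h3 : dist p y' ≤ dist p (meshPoint δ b) + dist (meshPoint δ b) y + dist y y' := dist_triangle4 _ _ _ _
  rw [dist_comm p (meshPoint δ b)] at h3
  linarith

/-- **`A`-sites stay away from points off the arc `(ab)`.** [cite: Smirnov2010, §5] -/
theorem IsDiscretisation.eventually_zdArcA_far (hDE : IsDiscretisation D E) {p : ℂ} (hp0 : p ∉ D.arc 0) :
    ∃ r > 0, 8 * r ≤ infDist p (D.arc 0) ∧ ∀ᶠ δ in 𝓝[>] (0 : ℝ), (E δ).IsZdAdmissible →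
      ∀ a ∈ (E δ).zdArcA, 6 * r ≤ dist (meshPoint δ a) p := by
  have hpos : 0 < infDist p (D.arc 0) :=
    ((D.isClosed_arc 0).notMem_iff_infDist_pos ⟨_, D.pt_mem_arc_self 0⟩).1 hp0
  refine ⟨infDist p (D.arc 0) / 8, by positivity, by linarith, ?_⟩
  set r := infDist p (D.arc 0) / 8 with hr
  have hr0 : 0 < r := by positivity
  have hH : ∀ᶠ δ in 𝓝[>] (0 : ℝ), hausdorffEDist (E δ).arcA (D.arc 0) < ENNReal.ofReal r :=
    hDE.tendsto_arcA (Iio_mem_nhds (ENNReal.ofReal_pos.2 hr0))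
  have hsmall : ∀ᶠ δ in 𝓝[>] (0 : ℝ), δ < r / 3 := nhdsWithin_le_nhds (Iio_mem_nhds (by positivity))
  filter_upwards [hH, hsmall, (self_mem_nhdsWithin : ∀ᶠ δ in 𝓝[>] (0 : ℝ), 0 < δ)] with δ hHδ hδs hδ0 hE a ha
  have hδ0' : 0 < δ := hδ0
  have hΩ := hDE.Ω_eq δ
  have hδE := hDE.δ_eq δ
  obtain ⟨z, hz, hzd⟩ := exists_frontier_near_of_mem_zdBoundary₀ (Dm := D.toJordanDomain) hΩ (by rw [hδE]; exact hδ0')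
    ((E δ).zdArcA_subset_zdBoundary ha)
  rw [hδE] at hzd
  have h1 : infDist (meshPoint δ a) (E δ).arcA ≤ 2 * δ := by
    have := infDist_le_dist_of_mem_zdDiscreteArc (A' := (E δ).arcA) ha (z := z) (by rw [hΩ]; exact hz)
    rw [hδE] at this
    rw [dist_comm] at hzd
    exact this.trans hzd
  obtain ⟨y, hy, hyd⟩ := (infDist_lt_iff hE.arcA_nonempty).1 (h1.trans_lt (by linarith : 2 * δ < 3 * δ))
  obtain ⟨y', hy', hyy'⟩ := exists_edist_lt_of_hausdorffEDist_lt hy hHδ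
  rw [edist_lt_ofReal] at hyy'
  have h2 : infDist p (D.arc 0) ≤ dist p y' := infDist_le_dist_of_mem hy'
  have h3 : dist p y' ≤ dist p (meshPoint δ a) + dist (meshPoint δ a) y + dist y y' := dist_triangle4 _ _ _ _
  rw [dist_comm p (meshPoint δ a)] at h3
  linarith

/-- The medial vertex of a dart is within `δ/2` of its vertex. [folklore] -/
theorem dist_medialPoint_cSrc_le {δ : ℝ} (hδ : 0 ≤ δ) (q : Site 2 × Fin 4) :
    dist (medialPoint δ (cSrc q)) (meshPoint δ q.1) ≤ δ / 2 := by
  rw [medialPoint_cSrc, dist_eq_norm, add_sub_cancel_left, norm_div, norm_mul, norm_pow, Complex.norm_I, one_pow,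
    mul_one, Complex.norm_real, Real.norm_eq_abs, abs_of_nonneg hδ, Complex.norm_two]

/-- **Fluxes are eventually small away from the arc `(ba)`**: for `p ∉ D.arc 1` and `ε > 0`
there is `r > 0` (`8r ≤ dist(p, arc 1)`) such that for all small meshes the `B`-sites are `6r`-far
from `p` and every dart at a vertex within `4r` of `p` has flux `≤ ε` (the a priori estimate
`dartFlux_le_of_infDist`, node 4). [cite: Smirnov2010, Lemma 4.8 and §5] -/
theorem IsDiscretisation.eventually_dartFlux_le_near (hDE : IsDiscretisation D E) {p : ℂ} (hp1 : p ∉ D.arc 1)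
    {ε : ℝ} (hε : 0 < ε) :
    ∃ r > 0, 8 * r ≤ infDist p (D.arc 1) ∧ ∀ᶠ δ in 𝓝[>] (0 : ℝ), ∀ hE : (E δ).IsZdAdmissible,
      (∀ b ∈ (E δ).zdArcB, 6 * r ≤ dist (meshPoint δ b) p) ∧
      ∀ q : Site 2 × Fin 4, cSrc q ∈ (discreteDomainGraph (E δ).Ω (E δ).δ).edgeSet →
        dist (meshPoint δ q.1) p < 4 * r → @dartFlux (E δ) ((E δ).admFintype hE) hE q ≤ ε := by
  obtain ⟨r, hr, hr8, hfar⟩ := hDE.eventually_zdArcB_far hp1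
  obtain ⟨ρf, hρf, hflux⟩ := dartFlux_le_of_infDist r hr
  have hρε : ∀ᶠ δ in 𝓝[>] (0 : ℝ), ρf δ < ε := hρf (Iio_mem_nhds hε)
  have hsmall : ∀ᶠ δ in 𝓝[>] (0 : ℝ), δ < r := nhdsWithin_le_nhds (Iio_mem_nhds hr)
  refine ⟨r, hr, hr8, ?_⟩
  filter_upwards [hfar, hρε, hsmall, (self_mem_nhdsWithin : ∀ᶠ δ in 𝓝[>] (0 : ℝ), 0 < δ)] with δ hfarδ hρδ hδr hδ0 hE
  have hδ0' : 0 < δ := hδ0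
  have hδE := hDE.δ_eq δ
  refine ⟨hfarδ hE, fun q hq hqp => ?_⟩
  letI := (E δ).admFintype hE
  have key := hflux D.toJordanDomain (E δ) (hDE.Ω_eq δ) hE q hq (Or.inr ?_)
  · rw [hδE] at key; exact key.trans hρδ.le
  · rw [hδE]
    obtain ⟨b₀, hb₀⟩ := hE.zdArcB_nonempty
    have hne : (meshPoint δ '' (E δ).zdArcB).Nonempty := ⟨_, b₀, hb₀, rfl⟩
    refine (le_infDist hne).2 ?_
    rintro _ ⟨b, hb, rfl⟩
    have h1 := hfarδ hE b hb
    have h2 := dist_medialPoint_cSrc_le hδ0'.le q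
    have h3 : dist (meshPoint δ b) p ≤ dist (meshPoint δ b) (medialPoint δ (cSrc q)) + dist (medialPoint δ (cSrc q)) (meshPoint δ q.1) +
        dist (meshPoint δ q.1) p := dist_triangle4 _ _ _ _
    rw [dist_comm (meshPoint δ b) (medialPoint δ (cSrc q))] at h3
    linarith

/-- **Fluxes are eventually small away from the arc `(ab)`** (symmetric statement). [cite: Smirnov2010, Lemma 4.8 and §5] -/
theorem IsDiscretisation.eventually_dartFlux_le_near' (hDE : IsDiscretisation D E) {p : ℂ} (hp0 : p ∉ D.arc 0)
    {ε : ℝ} (hε : 0 < ε) :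
    ∃ r > 0, 8 * r ≤ infDist p (D.arc 0) ∧ ∀ᶠ δ in 𝓝[>] (0 : ℝ), ∀ hE : (E δ).IsZdAdmissible,
      (∀ a ∈ (E δ).zdArcA, 6 * r ≤ dist (meshPoint δ a) p) ∧
      ∀ q : Site 2 × Fin 4, cSrc q ∈ (discreteDomainGraph (E δ).Ω (E δ).δ).edgeSet →
        dist (meshPoint δ q.1) p < 4 * r → @dartFlux (E δ) ((E δ).admFintype hE) hE q ≤ ε := by
  obtain ⟨r, hr, hr8, hfar⟩ := hDE.eventually_zdArcA_far hp0
  obtain ⟨ρf, hρf, hflux⟩ := dartFlux_le_of_infDist r hr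
  have hρε : ∀ᶠ δ in 𝓝[>] (0 : ℝ), ρf δ < ε := hρf (Iio_mem_nhds hε)
  have hsmall : ∀ᶠ δ in 𝓝[>] (0 : ℝ), δ < r := nhdsWithin_le_nhds (Iio_mem_nhds hr)
  refine ⟨r, hr, hr8, ?_⟩
  filter_upwards [hfar, hρε, hsmall, (self_mem_nhdsWithin : ∀ᶠ δ in 𝓝[>] (0 : ℝ), 0 < δ)] with δ hfarδ hρδ hδr hδ0 hE
  have hδ0' : 0 < δ := hδ0
  have hδE := hDE.δ_eq δ
  refine ⟨hfarδ hE, fun q hq hqp => ?_⟩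
  letI := (E δ).admFintype hE
  have key := hflux D.toJordanDomain (E δ) (hDE.Ω_eq δ) hE q hq (Or.inl ?_)
  · rw [hδE] at key; exact key.trans hρδ.le
  · rw [hδE]
    obtain ⟨a₀, ha₀⟩ := hE.zdArcA_nonempty
    have hne : (meshPoint δ '' (E δ).zdArcA).Nonempty := ⟨_, a₀, ha₀, rfl⟩
    refine (le_infDist hne).2 ?_
    rintro _ ⟨a, ha, rfl⟩
    have h1 := hfarδ hE a ha
    have h2 := dist_medialPoint_cSrc_le hδ0'.le q
    have h3 : dist (meshPoint δ a) p ≤ dist (meshPoint δ a) (medialPoint δ (cSrc q)) + dist (medialPoint δ (cSrc q)) (meshPoint δ q.1) +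
        dist (meshPoint δ q.1) p := dist_triangle4 _ _ _ _
    rw [dist_comm (meshPoint δ a) (medialPoint δ (cSrc q))] at h3
    linarith

end Family

/-! ### Geometry of the scales -/

section Scales

open DiscreteDobrushin

/-- Corner offsets are within sup-distance `1`. [folklore] -/
theorem supNear_add_cornerOff (f : Site 2) (j : Fin 4) : supNear f 1 (f + cornerOff j) := by
  intro i; fin_cases i <;> fin_cases j <;> simp [cornerOff]

/-- `faceAt v k` is within sup-distance `1` of `v`. [folklore] -/
theorem supNear_faceAt (v : Site 2) (k : Fin 4) : supNear v 1 (faceAt v k) := by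
  intro i; fin_cases i <;> fin_cases k <;> simp [faceAt, cornerOff]

/-- A mesh-distance bound gives a sup-box membership. [folklore] -/
theorem mem_sqBox_of_dist_le {δ : ℝ} (hδ : 0 < δ) {x c : Site 2} {R : ℤ} {d : ℝ}
    (hd : dist (meshPoint δ x) (meshPoint δ c) ≤ d) (hR : d ≤ δ * R) : x ∈ sqBox c R := by
  have key : ∀ i : Fin 2, |x i - c i| ≤ R := by
    intro i
    have h1 := abs_sub_mul_le_dist_meshPoint' δ c x i
    rw [abs_of_pos hδ] at h1
    have h2 : δ * |((x i : ℤ) : ℝ) - c i| ≤ δ * R := (h1.trans hd).trans hR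
    have h3 := le_of_mul_le_mul_left h2 hδ
    have : ((|x i - c i| : ℤ) : ℝ) ≤ R := by push_cast; exact h3
    exact_mod_cast this
  exact ⟨key 0, key 1⟩

end Scales

/-! ### Boundary values of `Hw` near the open arc `(ab)` -/

section Main

variable {D : RandomPlanarGeometry.DobrushinDomain} {E : ℝ → DiscreteDobrushin}

open DiscreteDobrushin in
/-- **`Hw - H_A ≤ η` near the open arc `(ab)`, eventually in the mesh** (Smirnov 2010, §5 with
Lemma B.3 for `H`; the boundary value `0` of `H` on `(ab)`). For a discretisation `E` of `D`, a point
`p` of the arc `(ab)` off the arc `(ba)` and `η > 0`, there is `ρ > 0` such that for all small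
`δ > 0`: for admissible data with connected wired arc and any FK primitive `(Hw, Hb)` constant on
the `A`- and `B`-sites, every site `v` cornering an inner face with mesh point within `ρ` of `p`
satisfies `Hw v - H_A ≤ η`. Ingredients: fluxes `≤ η/2` near `p` and `B`-sites far
(`eventually_dartFlux_le_near`), the comparison-plus-weak-Beurling estimate
`hw_sub_le_near_arcA` inside the hole-free complement of the exterior lattice component, which
comes within `ρ/2` of `p` (`eventually_exists_extConn_near`), over `J` scales with
`(1 - c_*)^J < η/2`. [cite: Smirnov2010, §5 and Lemma B.3] -/
theorem IsDiscretisation.eventually_hw_sub_le_near_arcA (hDE : IsDiscretisation D E) {p : ℂ}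
    (hp0 : p ∈ D.arc 0) (hp1 : p ∉ D.arc 1) {η : ℝ} (hη : 0 < η) :
    ∃ ρ > 0, ∀ᶠ δ in 𝓝[>] (0 : ℝ), ∀ (hE : (E δ).IsZdAdmissible)
      (_hA : ((discreteDomainGraph (E δ).Ω (E δ).δ).induce (E δ).zdArcA).Preconnected) (Hw Hb : Site 2 → ℝ),
      @IsFKPrimitive (E δ) ((E δ).admFintype hE) hE Hw Hb →
      (∀ a' ∈ (E δ).zdArcA, (∃ k, (E δ).IsInnerFace (faceAt a' k)) → Hw a' = Hw (startCorner hE).1) →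
      (∀ b ∈ (E δ).zdArcB, (∃ k, (E δ).IsInnerFace (faceAt b k)) →
        Hw b = Hw ((startCorner hE).1 + cornerUnit (startCorner hE).2)) →
      ∀ (v : Site 2) (k : Fin 4), (E δ).IsInnerFace (faceAt v k) → dist (meshPoint δ v) p < ρ →
        Hw v - Hw (startCorner hE).1 ≤ η := by
  -- scales
  have hc0 := maneuverConst_pos
  have hc1 := maneuverConst_le_one
  obtain ⟨J, hJ⟩ := exists_pow_lt_of_lt_one (show 0 < η / 2 by positivity) (show 1 - maneuverConst < 1 by linarith)
  obtain ⟨r, hr, -, hfl⟩ := hDE.eventually_dartFlux_le_near hp1 (ε := η / 2) (by positivity)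
  set ρ : ℝ := r / (125 * 5 ^ J) with hρdef
  have hρ : 0 < ρ := by positivity
  have hρr : 20 * 5 ^ J * ρ < r := by
    rw [hρdef]; rw [show 20 * 5 ^ J * (r / (125 * 5 ^ J)) = r * (20 / 125) by field_simp]; nlinarith
  have hρr' : ρ ≤ r := by
    rw [hρdef, div_le_iff₀ (by positivity)]
    have : (1 : ℝ) ≤ 5 ^ J := one_le_pow₀ (by norm_num)
    nlinarith
  have hext := eventually_exists_extConn_near D.toJordanDomain (D.arc_subset_frontier 0 hp0) (ρ := ρ / 2) (by positivity)
  have hsmall : ∀ᶠ δ in 𝓝[>] (0 : ℝ), δ < ρ / 1000 := nhdsWithin_le_nhds (Iio_mem_nhds (by positivity))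
  refine ⟨ρ, hρ, ?_⟩
  filter_upwards [hfl, hext, hsmall, (self_mem_nhdsWithin : ∀ᶠ δ in 𝓝[>] (0 : ℝ), 0 < δ)]
    with δ hflδ hextδ hδs hδ0' hE hA Hw Hb hprim hcA hcB v k hvk hvp
  have hδ0 : 0 < δ := hδ0'
  letI := (E δ).admFintype hE
  have hΩ := hDE.Ω_eq δ
  have hδE := hDE.δ_eq δ
  obtain ⟨hBfar, hflux⟩ := hflδ hE
  obtain ⟨F₀, hF₀p, hF₀ext⟩ := hextδ
  -- the lattice data
  set c : Site 2 := nearestSite δ p with hc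
  have hcp : dist (meshPoint δ c) p ≤ δ := dist_meshPoint_nearestSite_le hδ0 p
  set k₀ : ℕ := ⌊ρ / δ⌋₊ with hk₀def
  have hk₀le : (k₀ : ℝ) ≤ ρ / δ := Nat.floor_le (by positivity)
  have hk₀lt : ρ / δ < k₀ + 1 := Nat.lt_floor_add_one _
  have hρδ : 1000 < ρ / δ := by rw [lt_div_iff₀ hδ0]; linarith
  have hk₀ : 0 < k₀ := by
    have : (0 : ℝ) < k₀ := by linarith
    exact_mod_cast this
  have hk₀δ : (k₀ : ℝ) * δ ≤ ρ := by rwa [le_div_iff₀ hδ0] at hk₀le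
  have hk₀δ' : ρ < (k₀ + 1) * δ := by rwa [div_lt_iff₀ hδ0] at hk₀lt
  set R : ℤ := 10 * 5 ^ J * k₀ with hRdef
  set Bl : Set (Site 2) := {f | dist (meshPoint δ f) p < 3 * r} with hBl
  set K : Set (Site 2) := (ExtConn D.carrier δ)ᶜ with hK
  -- membership in boxes from mesh distances to `c`
  have hbox : ∀ (x : Site 2) (d : ℝ), dist (meshPoint δ x) p ≤ d → d + δ ≤ δ * (12 * k₀) → x ∈ mB c k₀ := by
    intro x d hd hd'
    rw [mB_eq_sqBox]
    refine mem_sqBox_of_dist_le hδ0 (d := d + δ) ?_ (by push_cast; linarith)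
    calc dist (meshPoint δ x) (meshPoint δ c) ≤ dist (meshPoint δ x) p + dist p (meshPoint δ c) := dist_triangle _ _ _
      _ ≤ d + δ := add_le_add hd (by rw [dist_comm]; exact hcp)
  have h12 : ρ + 3 * δ + δ ≤ δ * (12 * k₀) := by nlinarith
  -- apply the lattice estimate
  have key := hw_sub_le_near_arcA (E := E δ) hprim hA hcA hcB (Bl := Bl)
    (((E δ).interiorFaces_finite hE).subset inter_subset_left) ?_ (η₁ := η / 2) (by positivity) ?_
    (K := K) (holeFree_compl_extConn D.carrier δ) ?_ c hk₀ (F₀ := F₀) (by rw [hK, Set.mem_compl_iff, not_not]; exact hF₀ext)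
    (hbox F₀ (ρ / 2) hF₀p.le (by linarith)) (R := R) ?_ J (by rw [hRdef]) hvk ?_ ?_
  · calc Hw v - Hw (startCorner hE).1 ≤ η / 2 + (1 - maneuverConst) ^ J := key
      _ ≤ η := by linarith
  · -- no `B`-corners in the ball
    intro f hf j hb
    have h1 := hBfar _ hb
    have h2 := dist_meshPoint_le_of_supNear hδ0.le (supNear_add_cornerOff f j)
    push_cast at h2
    have h3 : dist (meshPoint δ (f + cornerOff j)) p ≤ dist (meshPoint δ (f + cornerOff j)) (meshPoint δ f) + dist (meshPoint δ f) p :=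
      dist_triangle _ _ _
    have hf' : dist (meshPoint δ f) p < 3 * r := hf
    linarith
  · -- fluxes at the darts of faces of the ball
    intro f hf hfin j
    refine hflux (f + cornerOff j, j) ?_ ?_
    · have : (E δ).IsInnerFace (faceAt (f + cornerOff j) j) := by rw [faceAt_add_cornerOff]; exact hfin
      exact (SimpleGraph.mem_edgeSet _).2 (adj_of_isInnerFace_faceAt this (Or.inl rfl))
    · have h2 := dist_meshPoint_le_of_supNear hδ0.le (supNear_add_cornerOff f j)
      push_cast at h2
      have h3 : dist (meshPoint δ (f + cornerOff j)) p ≤ dist (meshPoint δ (f + cornerOff j)) (meshPoint δ f) + dist (meshPoint δ f) p :=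
        dist_triangle _ _ _
      have hf' : dist (meshPoint δ f) p < 3 * r := hf
      simp only; linarith
  · -- interior faces of the ball lie in `K`
    rintro f ⟨hf, -⟩
    rw [hK, Set.mem_compl_iff]
    apply not_mem_extConn_of_mem
    have hin := (E δ).interiorFaces_subset_innerFaces hf
    have h0 : (E δ).IsInnerFace (faceAt f 0) := by
      rw [show faceAt f 0 = f by simp [faceAt, cornerOff]]; exact hin
    have hdom := (discreteDomainGraph_adj_iff.1 (adj_of_isInnerFace_faceAt h0 (Or.inl rfl))).2.1
    have := meshDomain_subset_meshVertices _ _ hdom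
    rw [mem_meshVertices_iff, hΩ, hδE] at this
    exact this
  · -- the big box lies in the ball
    intro y hy
    have h1 : dist (meshPoint δ y) (meshPoint δ c) ≤ δ * (2 * R) := by
      have := dist_meshPoint_le_of_supNear hδ0.le (s := R) (v := c) (w := y) (fun i => by
        have := hy; rcases this with ⟨h0, h1⟩; fin_cases i <;> assumption)
      exact this
    have h2 : δ * (2 * (R : ℝ)) < r := by
      rw [hRdef]; push_cast
      calc δ * (2 * (10 * 5 ^ J * (k₀ : ℝ))) = 20 * 5 ^ J * (k₀ * δ) := by ring
        _ ≤ 20 * 5 ^ J * ρ := by gcongr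
        _ < r := hρr
    have h1' : dist (meshPoint δ y) (meshPoint δ c) ≤ δ * (2 * (R : ℝ)) := by exact_mod_cast h1
    show dist (meshPoint δ y) p < 3 * r
    calc dist (meshPoint δ y) p ≤ dist (meshPoint δ y) (meshPoint δ c) + dist (meshPoint δ c) p := dist_triangle _ _ _
      _ < r + δ := add_lt_add_of_lt_of_le (h1'.trans_lt h2) hcp
      _ ≤ 3 * r := by linarith
  · -- the face of `v` lies in the ball
    have h2 := dist_meshPoint_le_of_supNear hδ0.le (supNear_faceAt v k)
    push_cast at h2
    show dist (meshPoint δ (faceAt v k)) p < 3 * r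
    calc dist (meshPoint δ (faceAt v k)) p ≤ dist (meshPoint δ (faceAt v k)) (meshPoint δ v) + dist (meshPoint δ v) p := dist_triangle _ _ _
      _ < δ * (2 * 1) + ρ := add_lt_add_of_le_of_lt h2 hvp
      _ ≤ 3 * r := by linarith
  · -- the face of `v` lies in the small box
    have h2 := dist_meshPoint_le_of_supNear hδ0.le (supNear_faceAt v k)
    push_cast at h2
    refine hbox (faceAt v k) (ρ + 3 * δ) ?_ h12
    calc dist (meshPoint δ (faceAt v k)) p ≤ dist (meshPoint δ (faceAt v k)) (meshPoint δ v) + dist (meshPoint δ v) p := dist_triangle _ _ _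
      _ ≤ δ * (2 * 1) + ρ := add_le_add h2 hvp.le
      _ ≤ ρ + 3 * δ := by linarith

open DiscreteDobrushin in
/-- **`H_B - Hw ≤ η` near the open arc `(ba)`, eventually in the mesh** (the boundary value `1`
of `H` on `(ba)`): interior sites by `sub_hw_le_near_arcB`, `B`-sites exactly, and the remaining
sites off the discrete boundary by `hw_ge_of_not_interiorSite'`. [cite: Smirnov2010, §5 and Lemma B.3] -/
theorem IsDiscretisation.eventually_sub_hw_le_near_arcB (hDE : IsDiscretisation D E) {p : ℂ}
    (hp1 : p ∈ D.arc 1) (hp0 : p ∉ D.arc 0) {η : ℝ} (hη : 0 < η) :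
    ∃ ρ > 0, ∀ᶠ δ in 𝓝[>] (0 : ℝ), ∀ (hE : (E δ).IsZdAdmissible)
      (_hA : ((discreteDomainGraph (E δ).Ω (E δ).δ).induce (E δ).zdArcA).Preconnected) (Hw Hb : Site 2 → ℝ),
      @IsFKPrimitive (E δ) ((E δ).admFintype hE) hE Hw Hb →
      (∀ a' ∈ (E δ).zdArcA, (∃ k, (E δ).IsInnerFace (faceAt a' k)) → Hw a' = Hw (startCorner hE).1) →
      (∀ b ∈ (E δ).zdArcB, (∃ k, (E δ).IsInnerFace (faceAt b k)) →
        Hw b = Hw ((startCorner hE).1 + cornerUnit (startCorner hE).2)) →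
      ∀ (v : Site 2) (k : Fin 4), (E δ).IsInnerFace (faceAt v k) → dist (meshPoint δ v) p < ρ →
        Hw ((startCorner hE).1 + cornerUnit (startCorner hE).2) - Hw v ≤ η := by
  have hc0 := maneuverConst_pos
  have hc1 := maneuverConst_le_one
  obtain ⟨J, hJ⟩ := exists_pow_lt_of_lt_one (show 0 < η / 2 by positivity) (show 1 - maneuverConst < 1 by linarith)
  obtain ⟨r, hr, -, hfl⟩ := hDE.eventually_dartFlux_le_near' hp0 (ε := η / 2) (by positivity)
  set ρ : ℝ := r / (125 * 5 ^ J) with hρdef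
  have hρ : 0 < ρ := by positivity
  have hρr : 20 * 5 ^ J * ρ < r := by
    rw [hρdef]; rw [show 20 * 5 ^ J * (r / (125 * 5 ^ J)) = r * (20 / 125) by field_simp]; nlinarith
  have hρr' : ρ ≤ r := by
    rw [hρdef, div_le_iff₀ (by positivity)]
    have : (1 : ℝ) ≤ 5 ^ J := one_le_pow₀ (by norm_num)
    nlinarith
  have hext := eventually_exists_extConn_near D.toJordanDomain (D.arc_subset_frontier 1 hp1) (ρ := ρ / 2) (by positivity)
  have hsmall : ∀ᶠ δ in 𝓝[>] (0 : ℝ), δ < ρ / 1000 := nhdsWithin_le_nhds (Iio_mem_nhds (by positivity))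
  refine ⟨ρ, hρ, ?_⟩
  filter_upwards [hfl, hext, hsmall, (self_mem_nhdsWithin : ∀ᶠ δ in 𝓝[>] (0 : ℝ), 0 < δ)]
    with δ hflδ hextδ hδs hδ0' hE hA Hw Hb hprim hcA hcB v k hvk hvp
  have hδ0 : 0 < δ := hδ0'
  letI := (E δ).admFintype hE
  have hΩ := hDE.Ω_eq δ
  have hδE := hDE.δ_eq δ
  obtain ⟨hAfar, hflux⟩ := hflδ hE
  obtain ⟨F₀, hF₀p, hF₀ext⟩ := hextδ
  set HB := Hw ((startCorner hE).1 + cornerUnit (startCorner hE).2) with hHB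
  -- small fluxes at `v`
  have hfluxv : ∀ j : Fin 4, dartFlux (E δ) hE (v, j) ≤ η / 2 := by
    intro j
    by_cases hj : (E δ).IsInnerFace (faceAt v j)
    · exact hflux (v, j) ((SimpleGraph.mem_edgeSet _).2 (adj_of_isInnerFace_faceAt hj (Or.inl rfl))) (by simp only; linarith)
    · -- darts whose face is not inner have flux `0`? not needed: use the inner face `k` only where required.
      -- (`hw_ge_of_not_interiorSite'` asks for all `j`; non-inner faces cannot occur off the boundary.)
      by_cases hnb : v ∈ (E δ).zdBoundary
      · -- on the boundary: `v ∈ A ∪ B`; `A` is far, and for `B`-sites the flux vanishes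
        rcases hE.zdBoundary_subset hnb with ha | hb
        · exfalso; have h6 := hAfar v ha; linarith
        · rw [dartFlux_eq_zero_of_mem_zdArcB hE (q := (v, j)) hb]; positivity
      · exact absurd (isInnerFace_faceAt_of_not_mem_zdBoundary hvk hnb j) hj
  by_cases hvint : v ∈ (E δ).interiorSites
  · -- interior site: comparison plus weak Beurling on the sites
    set c : Site 2 := nearestSite δ p with hc
    have hcp : dist (meshPoint δ c) p ≤ δ := dist_meshPoint_nearestSite_le hδ0 p
    set k₀ : ℕ := ⌊ρ / δ⌋₊ with hk₀def
    have hk₀le : (k₀ : ℝ) ≤ ρ / δ := Nat.floor_le (by positivity)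
    have hk₀lt : ρ / δ < k₀ + 1 := Nat.lt_floor_add_one _
    have hρδ : 1000 < ρ / δ := by rw [lt_div_iff₀ hδ0]; linarith
    have hk₀ : 0 < k₀ := by
      have : (0 : ℝ) < k₀ := by linarith
      exact_mod_cast this
    have hk₀δ : (k₀ : ℝ) * δ ≤ ρ := by rwa [le_div_iff₀ hδ0] at hk₀le
    have hk₀δ' : ρ < (k₀ + 1) * δ := by rwa [div_lt_iff₀ hδ0] at hk₀lt
    set R : ℤ := 10 * 5 ^ J * k₀ with hRdef
    set Bl : Set (Site 2) := {y | dist (meshPoint δ y) p < 3 * r} with hBl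
    set K : Set (Site 2) := (ExtConn D.carrier δ)ᶜ with hK
    have hbox : ∀ (x : Site 2) (d : ℝ), dist (meshPoint δ x) p ≤ d → d + δ ≤ δ * (12 * k₀) → x ∈ mB c k₀ := by
      intro x d hd hd'
      rw [mB_eq_sqBox]
      refine mem_sqBox_of_dist_le hδ0 (d := d + δ) ?_ (by push_cast; linarith)
      calc dist (meshPoint δ x) (meshPoint δ c) ≤ dist (meshPoint δ x) p + dist p (meshPoint δ c) := dist_triangle _ _ _
        _ ≤ d + δ := add_le_add hd (by rw [dist_comm]; exact hcp)
    have key := sub_hw_le_near_arcB (E := E δ) hprim hA hcA hcB (Bl := Bl)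
      (((E δ).interiorSites_finite hE).subset inter_subset_left)
      (fun w hw ha => by have h6 := hAfar w ha; have hw' : dist (meshPoint δ w) p < 3 * r := hw; linarith)
      (η₁ := η / 2) (by positivity)
      (fun w hw j hj => hflux (w, j) ((SimpleGraph.mem_edgeSet _).2 (adj_of_isInnerFace_faceAt hj (Or.inl rfl)))
        (by have hw' : dist (meshPoint δ w) p < 3 * r := hw; simp only; linarith))
      (K := K) (holeFree_compl_extConn D.carrier δ) ?_ c hk₀ (F₀ := F₀)
      (by rw [hK, Set.mem_compl_iff, not_not]; exact hF₀ext) (hbox F₀ (ρ / 2) hF₀p.le (by linarith)) (R := R) ?_ J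
      (by rw [hRdef]) hvint (show dist (meshPoint δ v) p < 3 * r by linarith) (hbox v ρ hvp.le (by nlinarith))
    · calc HB - Hw v ≤ η / 2 + (1 - maneuverConst) ^ J := key
        _ ≤ η := by linarith
    · rintro w ⟨hw, -⟩
      rw [hK, Set.mem_compl_iff]
      apply not_mem_extConn_of_mem
      have hdom := (discreteDomainGraph_adj_iff.1 ((SimpleGraph.mem_edgeSet _).1 (hw 0).mem_edgeSet)).2.1
      have := meshDomain_subset_meshVertices _ _ hdom
      rw [mem_meshVertices_iff, hΩ, hδE] at this
      exact this
    · intro y hy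
      have h1 : dist (meshPoint δ y) (meshPoint δ c) ≤ δ * (2 * R) :=
        dist_meshPoint_le_of_supNear hδ0.le (s := R) (v := c) (w := y) (fun i => by
          rcases hy with ⟨h0, h1⟩; fin_cases i <;> assumption)
      have h2 : δ * (2 * (R : ℝ)) < r := by
        rw [hRdef]; push_cast
        calc δ * (2 * (10 * 5 ^ J * (k₀ : ℝ))) = 20 * 5 ^ J * (k₀ * δ) := by ring
          _ ≤ 20 * 5 ^ J * ρ := by gcongr
          _ < r := hρr
      have h1' : dist (meshPoint δ y) (meshPoint δ c) ≤ δ * (2 * (R : ℝ)) := by exact_mod_cast h1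
      show dist (meshPoint δ y) p < 3 * r
      calc dist (meshPoint δ y) p ≤ dist (meshPoint δ y) (meshPoint δ c) + dist (meshPoint δ c) p := dist_triangle _ _ _
        _ < r + δ := add_lt_add_of_lt_of_le (h1'.trans_lt h2) hcp
        _ ≤ 3 * r := by linarith
  · by_cases hnb : v ∈ (E δ).zdBoundary
    · rcases hE.zdBoundary_subset hnb with ha | hb
      · exfalso; have h6 := hAfar v ha; linarith
      · rw [hcB v hb ⟨k, hvk⟩]; simp only [hHB, sub_self]; exact hη.le
    · have := hw_ge_of_not_interiorSite' hprim hcB hvk hvint hnb hfluxv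
      linarith

end Main

end Literature.Probability.LatticeModels
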